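import Literature.Barriers.MatrixMultiplication.RectangularBarrier
import Literature.Computability.AlgebraicComplexity.FlagSupportAntichain
import HarnessLib

/-!
# The matrix multiplication side of the CLLZ barrier: `H_θ(supp(⟨s⟩ ⊗ ⟨n,n,m⟩))` and obliqueness

Topic `Literature/Barriers/MatrixMultiplication`; first of the proof files discharging the named fact
`CLLZ2025_alpha_barrier_CW` of `RectangularBarrier.lean`. For the tensor `D = ⟨s⟩ ⊗ ⟨n,n,m⟩`
(`kroneckerTensor (unitTensor K s) (matMulTensor K n n m)`, the right-hand side of a reduction of a
`T`-method, CLLZ Def. 3.9) this file provides the lower bound that replaces Lemma 4.1 / Lemma 3.7 of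
CLLZ in the flag-form barrier argument:

* `le_maxWeightedEntropy_support_unitKroneckerMatMul` — the uniform distribution on `supp D` has
  uniform marginals, so `H_θ(supp D) ≥ θ₀ log₂(snm) + θ₁ log₂(sn²) + θ₂ log₂(snm)`
  (`= log₂ s + (1 + θ₁) log₂ n + (1 − θ₁) log₂ m` for `θ ∈ P([3])`; CLLZ Lemma 4.1 with the
  normalisation `ζ^θ(⟨s⟩) = s`, in entropy form and in the tree's index convention).
* `isAntichain_support_unitKroneckerMatMul_lex` — `D` is oblique (CVZ Def. 2.18): after reindexing
  its three index types by the lexicographic orders `(σ, i, k)`, `(σ, i↓, j)`, `(σ, j, k)↓`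
  (type synonyms `Lex`/`ᵒᵈ`), its support is an antichain for the product order.
* `le_frame_unitKroneckerMatMul_lex` — consequently (by
  `maxWeightedEntropy_support_le_frame_of_isAntichain`, Strassen/CVZ Thm. 2.15) every frame of the
  reindexed `D` has down-closed support of `θ`-entropy at least the bound above.

No definitions; the reindexed tensor is written as an explicit lambda.

## References

* M. Christandl, F. Le Gall, V. Lysikov, J. Zuiddam, comput. complexity 34 (2025), Lemma 4.1,
  Thm. 3.10 (proof). [ChristandlLeGallLysikovZuiddam2025]
* M. Christandl, P. Vrana, J. Zuiddam, J. Amer. Math. Soc. 36 (2023), Def. 2.18, Thm. 2.19.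
  [ChristandlVranaZuiddam2023]
-/

noncomputable section

open scoped BigOperators

namespace Literature.Barriers.MatrixMultiplication

open Literature.Computability.AlgebraicComplexity

universe u

/-! ## Entropy of constant distributions -/

section Const

/-- The uniform distribution on a finite type with `N` elements has Shannon entropy `log₂ N`.
[folklore] -/
theorem shannonEntropy_const_inv {α : Type*} [Fintype α] {N : ℝ} (hN : (Fintype.card α : ℝ) = N)
    (hN0 : 0 < N) : shannonEntropy (fun _ : α => N⁻¹) = Real.log N / Real.log 2 := by
  rw [shannonEntropy_def]
  congr 1
  rw [Finset.sum_const, Finset.card_univ, nsmul_eq_mul, hN, Real.negMulLog, Real.log_inv]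
  field_simp

end Const

/-! ## The support of `⟨s⟩ ⊗ ⟨n,n,m⟩` and the uniform distribution on it -/

section MaMu

variable (K : Type u) [Field K]

/-- Entries of `D = ⟨s⟩ ⊗ ⟨n,n,m⟩`: `D` is the 0/1-indicator of
`σ₁ = σ₂ = σ₃ ∧ i₁ = i₂ ∧ j₂ = j₃ ∧ k₁ = k₃` at `((σ₁,(i₁,k₁)), (σ₂,(i₂,j₂)), (σ₃,(j₃,k₃)))`
(tree conventions of `unitTensor`, `matMulTensor`). [folklore] -/
theorem unitKroneckerMatMul_apply (s n m : ℕ) (a : Fin s × (Fin n × Fin m))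
    (b : Fin s × (Fin n × Fin n)) (c : Fin s × (Fin n × Fin m)) :
    kroneckerTensor (unitTensor K s) (matMulTensor K n n m) a b c =
      if a.1 = b.1 ∧ b.1 = c.1 ∧ a.2.1 = b.2.1 ∧ b.2.2 = c.2.1 ∧ a.2.2 = c.2.2 then 1 else 0 := by
  rw [kroneckerTensor_apply, unitTensor_apply]
  simp only [matMulTensor]
  by_cases h : a.1 = b.1 ∧ b.1 = c.1 ∧ a.2.1 = b.2.1 ∧ b.2.2 = c.2.1 ∧ a.2.2 = c.2.2
  · rw [if_pos h, if_pos ⟨h.1, h.2.1⟩, if_pos h.2.2, one_mul]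
  · rw [if_neg h]
    by_cases h' : a.1 = b.1 ∧ b.1 = c.1
    · rw [if_pos h', one_mul, if_neg]
      exact fun h'' => h ⟨h'.1, h'.2, h''⟩
    · rw [if_neg h', zero_mul]

/-- Membership in the support of `⟨s⟩ ⊗ ⟨n,n,m⟩`. [folklore] -/
theorem mem_tensorSupport_unitKroneckerMatMul (s n m : ℕ)
    (x : (Fin s × (Fin n × Fin m)) × (Fin s × (Fin n × Fin n)) × (Fin s × (Fin n × Fin m))) :
    x ∈ tensorSupport (kroneckerTensor (unitTensor K s) (matMulTensor K n n m)) ↔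
      x.1.1 = x.2.1.1 ∧ x.2.1.1 = x.2.2.1 ∧ x.1.2.1 = x.2.1.2.1 ∧ x.2.1.2.2 = x.2.2.2.1 ∧
        x.1.2.2 = x.2.2.2.2 := by
  rw [mem_tensorSupport, unitKroneckerMatMul_apply]
  constructor
  · intro h
    by_contra hc
    exact h (if_neg hc)
  · intro h
    rw [if_pos h]
    exact one_ne_zero

/-- **`H_θ(supp(⟨s⟩ ⊗ ⟨n,n,m⟩)) ≥ θ₀ log₂(snm) + θ₁ log₂(sn²) + θ₂ log₂(snm)`** for `s, n, m ≥ 1` and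
`θ ≥ 0`: the uniform distribution on the support (mass `1/(sn²m)` on each of its points, which are
parametrised by `(σ, i, j, k)`) has uniform marginals on the three index sets, of sizes `snm`, `sn²`,
`snm`. For `θ ∈ P([3])` the bound is `log₂ s + (1 + θ₁) log₂ n + (1 − θ₁) log₂ m`, the value of
`log₂ (ζ^θ(⟨s⟩) ζ^θ(⟨n,n,m⟩))` by CLLZ Lemma 4.1 in the tree's index convention.
[cite: ChristandlLeGallLysikovZuiddam2025, Lemma 4.1] -/
theorem le_maxWeightedEntropy_support_unitKroneckerMatMul {s n m : ℕ} (hs : 0 < s) (hn : 0 < n)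
    (hm : 0 < m) {θ : Fin 3 → ℝ} (hθ : ∀ i, 0 ≤ θ i) :
    θ 0 * (Real.log ((s : ℝ) * n * m) / Real.log 2) + θ 1 * (Real.log ((s : ℝ) * n * n) / Real.log 2) +
        θ 2 * (Real.log ((s : ℝ) * n * m) / Real.log 2) ≤
      maxWeightedEntropy θ (tensorSupport (kroneckerTensor (unitTensor K s) (matMulTensor K n n m))) := by
  have hs' : (0 : ℝ) < s := by exact_mod_cast hs
  have hn' : (0 : ℝ) < n := by exact_mod_cast hn
  have hm' : (0 : ℝ) < m := by exact_mod_cast hm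
  -- the uniform distribution on the support
  set Z : ℝ := ((s : ℝ) * n * n * m)⁻¹ with hZ
  have hZ0 : 0 ≤ Z := by positivity
  let P : (Fin s × (Fin n × Fin m)) × (Fin s × (Fin n × Fin n)) × (Fin s × (Fin n × Fin m)) → ℝ :=
    fun x => if x.1.1 = x.2.1.1 ∧ x.2.1.1 = x.2.2.1 ∧ x.1.2.1 = x.2.1.2.1 ∧ x.2.1.2.2 = x.2.2.2.1 ∧
      x.1.2.2 = x.2.2.2.2 then Z else 0
  have hPx : ∀ x, P x = if x.1.1 = x.2.1.1 ∧ x.2.1.1 = x.2.2.1 ∧ x.1.2.1 = x.2.1.2.1 ∧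
      x.2.1.2.2 = x.2.2.2.1 ∧ x.1.2.2 = x.2.2.2.2 then Z else 0 := fun _ => rfl
  -- the same at explicit tuples (clean decidability instances for the rewriting below)
  have hPx' : ∀ σ₁ i₁ k₁ σ₂ i₂ j₂ σ₃ j₃ k₃, P ((σ₁, (i₁, k₁)), ((σ₂, (i₂, j₂)), (σ₃, (j₃, k₃)))) =
      if σ₁ = σ₂ ∧ σ₂ = σ₃ ∧ i₁ = i₂ ∧ j₂ = j₃ ∧ k₁ = k₃ then Z else 0 :=
    fun _ _ _ _ _ _ _ _ _ => rfl
  -- its marginals are uniform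
  have hm₁ : ∀ a, marginalDist₁ P a = ((s : ℝ) * n * m)⁻¹ := by
    rintro ⟨σ, i, k⟩
    have h : marginalDist₁ P (σ, i, k) = n * Z := by
      simp only [marginalDist₁, Fintype.sum_prod_type]
      simp only [hPx']
      simp only [ite_and, Finset.sum_ite_irrel, Finset.sum_const_zero, Finset.sum_ite_eq,
        Finset.mem_univ, if_true, Finset.sum_const, Finset.card_univ, Fintype.card_fin, nsmul_eq_mul]
    rw [h, hZ]
    field_simp
  have hm₂ : ∀ b, marginalDist₂ P b = ((s : ℝ) * n * n)⁻¹ := by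
    rintro ⟨σ, i, j⟩
    have h : marginalDist₂ P (σ, i, j) = m * Z := by
      simp only [marginalDist₂, Fintype.sum_prod_type]
      simp only [hPx']
      simp only [ite_and, Finset.sum_ite_irrel, Finset.sum_const_zero, Finset.sum_ite_eq,
        Finset.sum_ite_eq', Finset.mem_univ, if_true, Finset.sum_const, Finset.card_univ,
        Fintype.card_fin, nsmul_eq_mul]
    rw [h, hZ]
    field_simp
  have hm₃ : ∀ c, marginalDist₃ P c = ((s : ℝ) * n * m)⁻¹ := by
    rintro ⟨σ, j, k⟩
    have h : marginalDist₃ P (σ, j, k) = n * Z := by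
      simp only [marginalDist₃, Fintype.sum_prod_type]
      simp only [hPx']
      simp only [ite_and, Finset.sum_ite_irrel, Finset.sum_const_zero, Finset.sum_ite_eq,
        Finset.sum_ite_eq', Finset.mem_univ, if_true, Finset.sum_const, Finset.card_univ,
        Fintype.card_fin, nsmul_eq_mul]
    rw [h, hZ]
    field_simp
  -- it is a probability distribution supported in the support
  have hP : P ∈ stdSimplex ℝ _ := by
    refine ⟨fun x => ?_, ?_⟩
    · rw [hPx]
      split_ifs
      · exact hZ0
      · exact le_rfl
    · calc ∑ x, P x = ∑ a, marginalDist₁ P a := by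
            simp only [marginalDist₁, Fintype.sum_prod_type]
        _ = ∑ _a : Fin s × (Fin n × Fin m), ((s : ℝ) * n * m)⁻¹ := Finset.sum_congr rfl fun a _ => hm₁ a
        _ = 1 := by
            rw [Finset.sum_const, Finset.card_univ, nsmul_eq_mul]
            simp only [Fintype.card_prod, Fintype.card_fin]
            push_cast
            field_simp
  have hsupp : Function.support P ⊆
      tensorSupport (kroneckerTensor (unitTensor K s) (matMulTensor K n n m)) := by
    intro x hx
    rw [mem_tensorSupport_unitKroneckerMatMul]
    by_contra h
    exact hx (by rw [hPx, if_neg h])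
  -- its weighted entropy is the bound
  have hcard₁ : (Fintype.card (Fin s × (Fin n × Fin m)) : ℝ) = (s : ℝ) * n * m := by
    simp only [Fintype.card_prod, Fintype.card_fin]
    push_cast
    ring
  have hcard₂ : (Fintype.card (Fin s × (Fin n × Fin n)) : ℝ) = (s : ℝ) * n * n := by
    simp only [Fintype.card_prod, Fintype.card_fin]
    push_cast
    ring
  have hH : weightedEntropy θ P = θ 0 * (Real.log ((s : ℝ) * n * m) / Real.log 2) +
      θ 1 * (Real.log ((s : ℝ) * n * n) / Real.log 2) +
      θ 2 * (Real.log ((s : ℝ) * n * m) / Real.log 2) := by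
    have e₁ : marginalDist₁ P = fun _ => ((s : ℝ) * n * m)⁻¹ := funext hm₁
    have e₂ : marginalDist₂ P = fun _ => ((s : ℝ) * n * n)⁻¹ := funext hm₂
    have e₃ : marginalDist₃ P = fun _ => ((s : ℝ) * n * m)⁻¹ := funext hm₃
    rw [weightedEntropy, e₁, e₂, e₃, shannonEntropy_const_inv hcard₁ (by positivity),
      shannonEntropy_const_inv hcard₂ (by positivity)]
  rw [← hH]
  exact weightedEntropy_le_maxWeightedEntropy hθ hP hsupp

/-! ## Obliqueness: the support is an antichain for lexicographic reindexings -/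

/-- **`⟨s⟩ ⊗ ⟨n,n,m⟩` is oblique** (CVZ Def. 2.18; matrix multiplication tensors and unit tensors are
tight, hence oblique): reindex the three index types `(σ,(i,k))`, `(σ,(i,j))`, `(σ,(j,k))` by the
lexicographic orders `(σ, i, k)`, `(σ, i↓, j)` and the dual of `(σ, j, k)`; then two comparable
support points `(σ,i,j,k) ≤ (σ',i',j',k')` have `σ ≤ σ' ≤ σ`, then `i ≤ i' ≤ i`, then `j ≤ j' ≤ j`,
`k ≤ k' ≤ k`, so the support is an antichain for the product order. [cite: ChristandlVranaZuiddam2023, Def. 2.18] -/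
theorem isAntichain_support_unitKroneckerMatMul_lex (s n m : ℕ) :
    IsAntichain (· ≤ ·) (tensorSupport fun (a : Lex (Fin s × Lex (Fin n × Fin m)))
      (b : Lex (Fin s × Lex ((Fin n)ᵒᵈ × Fin n))) (c : (Lex (Fin s × Lex (Fin n × Fin m)))ᵒᵈ) =>
        kroneckerTensor (unitTensor K s) (matMulTensor K n n m)
          ((ofLex a).1, ((ofLex (ofLex a).2).1, (ofLex (ofLex a).2).2))
          ((ofLex b).1, (OrderDual.ofDual (ofLex (ofLex b).2).1, (ofLex (ofLex b).2).2))
          ((ofLex (OrderDual.ofDual c)).1,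
            ((ofLex (ofLex (OrderDual.ofDual c)).2).1, (ofLex (ofLex (OrderDual.ofDual c)).2).2))) := by
  rintro ⟨a, b, c⟩ hx ⟨a', b', c'⟩ hy hne hle
  -- decode the six synonym-typed coordinates
  obtain ⟨σ, i, k, rfl⟩ : ∃ σ i k, toLex (σ, toLex (i, k)) = a :=
    ⟨(ofLex a).1, (ofLex (ofLex a).2).1, (ofLex (ofLex a).2).2, rfl⟩
  obtain ⟨σb, ib, j, rfl⟩ : ∃ σb ib j, toLex (σb, toLex (OrderDual.toDual ib, j)) = b :=
    ⟨(ofLex b).1, OrderDual.ofDual (ofLex (ofLex b).2).1, (ofLex (ofLex b).2).2, rfl⟩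
  obtain ⟨σc, jc, kc, rfl⟩ : ∃ σc jc kc, OrderDual.toDual (toLex (σc, toLex (jc, kc))) = c :=
    ⟨(ofLex (OrderDual.ofDual c)).1, (ofLex (ofLex (OrderDual.ofDual c)).2).1,
      (ofLex (ofLex (OrderDual.ofDual c)).2).2, rfl⟩
  obtain ⟨σ', i', k', rfl⟩ : ∃ σ' i' k', toLex (σ', toLex (i', k')) = a' :=
    ⟨(ofLex a').1, (ofLex (ofLex a').2).1, (ofLex (ofLex a').2).2, rfl⟩
  obtain ⟨σb', ib', j', rfl⟩ : ∃ σb' ib' j', toLex (σb', toLex (OrderDual.toDual ib', j')) = b' :=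
    ⟨(ofLex b').1, OrderDual.ofDual (ofLex (ofLex b').2).1, (ofLex (ofLex b').2).2, rfl⟩
  obtain ⟨σc', jc', kc', rfl⟩ : ∃ σc' jc' kc', OrderDual.toDual (toLex (σc', toLex (jc', kc'))) = c' :=
    ⟨(ofLex (OrderDual.ofDual c')).1, (ofLex (ofLex (OrderDual.ofDual c')).2).1,
      (ofLex (ofLex (OrderDual.ofDual c')).2).2, rfl⟩
  -- the support conditions identify the coordinates of each point
  simp only [mem_tensorSupport, ofLex_toLex, OrderDual.ofDual_toDual, unitKroneckerMatMul_apply, ne_eq,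
    ite_eq_right_iff, one_ne_zero, imp_false, not_not] at hx hy
  obtain ⟨rfl, rfl, rfl, rfl, rfl⟩ := hx
  obtain ⟨rfl, rfl, rfl, rfl, rfl⟩ := hy
  -- the order conditions
  obtain ⟨ha, hbc⟩ := Prod.mk_le_mk.1 hle
  obtain ⟨hb, hc⟩ := Prod.mk_le_mk.1 hbc
  rw [Prod.Lex.toLex_le_toLex] at ha hb
  rw [OrderDual.toDual_le_toDual, Prod.Lex.toLex_le_toLex] at hc
  simp only at ha hb hc
  -- first coordinates agree
  have hσ : σ = σ' := by
    rcases ha with h | ⟨h, -⟩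
    · rcases hc with h' | ⟨h', -⟩
      · exact absurd (h.trans h') (lt_irrefl _)
      · rw [h'] at h
        exact absurd h (lt_irrefl _)
    · exact h
  subst hσ
  have hik : toLex (i, k) ≤ toLex (i', k') := by
    rcases ha with h | ⟨-, h⟩
    · exact absurd h (lt_irrefl _)
    · exact h
  have hij : toLex (OrderDual.toDual i, j) ≤ toLex (OrderDual.toDual i', j') := by
    rcases hb with h | ⟨-, h⟩
    · exact absurd h (lt_irrefl _)
    · exact h
  have hjk : toLex (j', k') ≤ toLex (j, k) := by
    rcases hc with h | ⟨-, h⟩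
    · exact absurd h (lt_irrefl _)
    · exact h
  rw [Prod.Lex.toLex_le_toLex] at hik hij hjk
  simp only at hik hij hjk
  -- second coordinates agree
  have hi : i = i' := by
    rcases hik with h | ⟨h, -⟩
    · rcases hij with h' | ⟨h', -⟩
      · exact absurd (h.trans (OrderDual.toDual_lt_toDual.1 h')) (lt_irrefl _)
      · rw [OrderDual.toDual_inj.1 h'] at h
        exact absurd h (lt_irrefl _)
    · exact h
  subst hi
  have hk₁ : k ≤ k' := by
    rcases hik with h | ⟨-, h⟩
    · exact absurd h (lt_irrefl _)
    · exact h
  have hj₁ : j ≤ j' := by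
    rcases hij with h | ⟨-, h⟩
    · exact absurd h (lt_irrefl _)
    · exact h
  -- third coordinates agree
  have hj : j = j' := by
    rcases hjk with h | ⟨h, -⟩
    · exact absurd (lt_of_le_of_lt hj₁ h) (lt_irrefl _)
    · exact h.symm
  subst hj
  have hk : k = k' := by
    rcases hjk with h | ⟨-, h⟩
    · exact absurd h (lt_irrefl _)
    · exact le_antisymm hk₁ h
  subst hk
  exact hne rfl

/-- **Every frame of the (reindexed, oblique) tensor `⟨s⟩ ⊗ ⟨n,n,m⟩` has down-closed support of
`θ`-entropy at least `θ₀ log₂(snm) + θ₁ log₂(sn²) + θ₂ log₂(snm)`** (`s, n, m ≥ 1`, `θ ≥ 0`): the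
lower bound `le_maxWeightedEntropy_support_unitKroneckerMatMul`, transported to the lexicographic
reindexing, followed by Strassen's comparison for antichain supports
(`maxWeightedEntropy_support_le_frame_of_isAntichain`). This is the inequality
`log F(⟨n,n,m⟩^{⊕s}) ≥ log s + log F(⟨n,n,m⟩)` of the proof of CLLZ Thm. 3.10 for the flag-form
support functional, with Lemma 4.1 evaluated. [cite: ChristandlLeGallLysikovZuiddam2025, Thm. 3.10 (proof) and Lemma 4.1] -/
theorem le_frame_unitKroneckerMatMul_lex {s n m : ℕ} (hs : 0 < s) (hn : 0 < n) (hm : 0 < m)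
    {θ : Fin 3 → ℝ} (hθ : ∀ i, 0 ≤ θ i) {N₁ N₂ N₃ : ℕ}
    (A : Matrix (Fin N₁) (Lex (Fin s × Lex (Fin n × Fin m))) K)
    (B : Matrix (Fin N₂) (Lex (Fin s × Lex ((Fin n)ᵒᵈ × Fin n))) K)
    (C : Matrix (Fin N₃) (Lex (Fin s × Lex (Fin n × Fin m)))ᵒᵈ K)
    (hA : Submodule.span K (Set.range A.row) = ⊤) (hB : Submodule.span K (Set.range B.row) = ⊤)
    (hC : Submodule.span K (Set.range C.row) = ⊤) :
    θ 0 * (Real.log ((s : ℝ) * n * m) / Real.log 2) + θ 1 * (Real.log ((s : ℝ) * n * n) / Real.log 2) +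
        θ 2 * (Real.log ((s : ℝ) * n * m) / Real.log 2) ≤
      maxWeightedEntropy θ {x | ∃ y ∈ tensorSupport (actTensor A B C
        fun (a : Lex (Fin s × Lex (Fin n × Fin m))) (b : Lex (Fin s × Lex ((Fin n)ᵒᵈ × Fin n)))
          (c : (Lex (Fin s × Lex (Fin n × Fin m)))ᵒᵈ) =>
          kroneckerTensor (unitTensor K s) (matMulTensor K n n m)
            ((ofLex a).1, ((ofLex (ofLex a).2).1, (ofLex (ofLex a).2).2))
            ((ofLex b).1, (OrderDual.ofDual (ofLex (ofLex b).2).1, (ofLex (ofLex b).2).2))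
            ((ofLex (OrderDual.ofDual c)).1, ((ofLex (ofLex (OrderDual.ofDual c)).2).1,
              (ofLex (ofLex (OrderDual.ofDual c)).2).2))), x ≤ y} := by
  classical
  refine (le_maxWeightedEntropy_support_unitKroneckerMatMul K hs hn hm hθ).trans ?_
  refine le_trans ?_ (maxWeightedEntropy_support_le_frame_of_isAntichain _
    (isAntichain_support_unitKroneckerMatMul_lex K s n m) A B C hA hB hC hθ)
  -- transport along the reindexing bijections
  refine maxWeightedEntropy_le_of_injOn hθ
    (fun a : Fin s × (Fin n × Fin m) => toLex (a.1, toLex (a.2.1, a.2.2)))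
    (fun b : Fin s × (Fin n × Fin n) => toLex (b.1, toLex (OrderDual.toDual b.2.1, b.2.2)))
    (fun c : Fin s × (Fin n × Fin m) => OrderDual.toDual (toLex (c.1, toLex (c.2.1, c.2.2))))
    ?_ ?_ ?_ ?_
  · rintro ⟨σ, i, k⟩ - ⟨σ', i', k'⟩ - h
    simp only [toLex_inj, Prod.mk.injEq] at h
    obtain ⟨rfl, rfl, rfl⟩ := h
    rfl
  · rintro ⟨σ, i, j⟩ - ⟨σ', i', j'⟩ - h
    simp only [toLex_inj, Prod.mk.injEq, OrderDual.toDual_inj] at h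
    obtain ⟨rfl, rfl, rfl⟩ := h
    rfl
  · rintro ⟨σ, j, k⟩ - ⟨σ', j', k'⟩ - h
    simp only [toLex_inj, Prod.mk.injEq, OrderDual.toDual_inj] at h
    obtain ⟨rfl, rfl, rfl⟩ := h
    rfl
  · intro x hx
    simpa [mem_tensorSupport] using hx

end MaMu

end Literature.Barriers.MatrixMultiplication

end
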